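import Summits.Parity.GeneralizedHardyLittlewood.Theorems.BeyondDiagonalBeatsQuarter.PeterssonSplitExpansion
import Literature.NumberTheory.LFunctions.KMVCentralValueSquaredAFEProofs
import Literature.NumberTheory.LFunctions.KowalskiMichelHarmonicMoments
import Literature.NumberTheory.ModularForms.NewformHeckeMultiplicativity
import HarnessLib

/-!
# Route `PrimeLevelFamEdge`, crux K_B (stmt-Parity-20343), line `diagonal_kernel_split`, helper H4
# (exact Petersson/AFE split), part (b): AFE ⊗ Hecke ⊗ Petersson for the twisted second moment

For `q` prime and `1 ≤ l, m < q`: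
`T_q(l,m) = Σ^h Λ(f,½)² λ_f(l)λ_f(m)
  = 2q̂ Σ_{n₁,n₂ ≥ 1} (n₁n₂)^{−1/2} W(n₁n₂/q̂²) Σ_{d₁ ∣ (l,n₁)} Σ_{d₂ ∣ (m,n₂)} Δ_q(l n₁/d₁², m n₂/d₂²)`,
`Δ_q(u,v) = Σ^h λ_f(u)λ_f(v)` (`KowalskiMichel2000.pet`), with absolute convergence — the exact
«approximate functional equation» H-AFE (`KMV2000.completedL_half_sq_eq_holds`, (21)–(22) at `k = 0`)
inserted into the finite harmonic average, Hecke multiplicativity below the level (`ε_q(d) = 1` for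
`d ∣ l < q`: `heckeLambda_mul_heckeLambda_of_coprime`) on each pair `λ_f(l)λ_f(n₁)`, `λ_f(m)λ_f(n₂)`,
and the definition of `Δ_q`. Part (c) splits `Δ_q = δ − J_q` (Petersson) and resums the diagonal.
Helper; an identity, no bound; closes nothing; standard axioms.
«The programme SEARCHES and TYPES; no claim about Landau–Siegel zeros, Theorems 1–2 of arXiv:2211.02515 or
a repaired Margin232 until a kernel theorem says so.»
-/

noncomputable section

open Finset Polynomial CongruenceSubgroup
open scoped Real

namespace Summit.Parity.GeneralizedHardyLittlewood.Theorems.BeyondDiagonalBeatsQuarter.PeterssonSplit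

open Literature.NumberTheory.LFunctions Literature.NumberTheory.LFunctions.KMV2000
open Literature.NumberTheory.EllipticCurves.ModularForms
open Literature.NumberTheory.ModularForms (heckeLambda_mul_heckeLambda_of_coprime)

variable {q : ℕ} [NeZero q]

/-- The AFE weight `w_q(n₁,n₂) = (n₁n₂)^{−1/2} W(n₁n₂/q̂²)` of (21), as a real number (a proof-local
abbreviation; `W = KMV2000.cutoffW`). [cite: KowalskiMichelVanderKam2000, (21) p. 12] -/
def afeWeight (q : ℕ) (n : ℕ × ℕ) : ℝ :=
  (((n.1 : ℝ) * n.2) ^ (-(1 / 2 : ℝ))) * cutoffW ((n.1 : ℝ) * n.2 / qhat q ^ 2)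

omit [NeZero q] in
/-- Unfolding `afeSqTerm` through `afeWeight`: `afeSqTerm f (n₁,n₂) = λ_f(n₁)λ_f(n₂)·w_q(n₁,n₂)`.
[cite: KowalskiMichelVanderKam2000, (21) p. 12] -/
theorem afeSqTerm_eq (f : CuspForm (Gamma0 q) 2) (n : ℕ × ℕ) :
    afeSqTerm q f n = GL2Family.heckeLambda f n.1 * GL2Family.heckeLambda f n.2 * (afeWeight q n : ℂ) := by
  simp only [afeSqTerm, afeWeight]
  push_cast
  ring

/-- Below a prime level the Hecke relation has no `ε_q`: for `1 ≤ l < q` prime and any `n`,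
`λ_f(l)λ_f(n) = Σ_{d ∣ (l,n)} λ_f(ln/d²)`. [cite: KowalskiMichelVanderKam2000, Lemma 3.1 (10) p. 8 with p. 13] -/
theorem heckeLambda_mul_below_level (hq : q.Prime) {f : CuspForm (Gamma0 q) 2} (hf : IsNewform0 f)
    {l : ℕ} (hl : 1 ≤ l) (hlq : l < q) (n : ℕ) :
    GL2Family.heckeLambda f l * GL2Family.heckeLambda f n =
      ∑ d ∈ (l.gcd n).divisors, GL2Family.heckeLambda f (l * n / d ^ 2) := by
  refine heckeLambda_mul_heckeLambda_of_coprime hf ?_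
  have h1 : l.gcd n ≤ l := Nat.gcd_le_left n hl
  have h2 : l.gcd n ≠ 0 := (Nat.gcd_pos_of_pos_left n hl).ne'
  exact (Nat.coprime_of_lt_prime h2 (lt_of_le_of_lt h1 hlq) hq).symm

/-- **H4 (b): AFE ⊗ Hecke ⊗ Petersson.** For `q` prime and `1 ≤ l, m < q`, the twisted harmonic second
moment is the absolutely convergent double series
`T_q(l,m) = 2q̂ Σ_{(n₁,n₂)} w_q(n₁,n₂) Σ_{d₁ ∣ (l,n₁)} Σ_{d₂ ∣ (m,n₂)} Δ_q(l n₁/d₁², m n₂/d₂²)`.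
[cite: KowalskiMichelVanderKam2000, (21)–(22) p. 12 and Lemma 3.1 (10) p. 8 — derivation] -/
theorem twistedSecond_eq_tsum (hq : q.Prime) {l m : ℕ} (hl : 1 ≤ l) (hlq : l < q) (hm : 1 ≤ m)
    (hmq : m < q) :
    Summable (fun n : ℕ × ℕ ↦ (afeWeight q n : ℂ) *
      ∑ d₁ ∈ (l.gcd n.1).divisors, ∑ d₂ ∈ (m.gcd n.2).divisors,
        KowalskiMichel2000.pet q (l * n.1 / d₁ ^ 2) (m * n.2 / d₂ ^ 2)) ∧
    twistedSecond q l m = 2 * (qhat q : ℂ) * ∑' n : ℕ × ℕ, (afeWeight q n : ℂ) *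
      ∑ d₁ ∈ (l.gcd n.1).divisors, ∑ d₂ ∈ (m.gcd n.2).divisors,
        KowalskiMichel2000.pet q (l * n.1 / d₁ ^ 2) (m * n.2 / d₂ ^ 2) := by
  have hfin := finite_newforms0_holds q 2
  set S := hfin.toFinset with hS
  -- the per-form summands and their sums
  set F : CuspForm (Gamma0 q) 2 → ℕ × ℕ → ℂ := fun f n ↦
    (GL2Family.harmonicWeight f : ℂ) * (afeSqTerm q f n *
      (GL2Family.heckeLambda f l * GL2Family.heckeLambda f m)) with hF
  have hHas : ∀ f ∈ S, HasSum (F f) ((GL2Family.harmonicWeight f : ℂ) *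
      ((∑' n : ℕ × ℕ, afeSqTerm q f n) * (GL2Family.heckeLambda f l * GL2Family.heckeLambda f m))) := by
    intro f hf
    have hf' : f ∈ newforms0 q 2 := (Set.Finite.mem_toFinset _).1 hf
    exact ((completedL_half_sq_eq_holds q hq f hf').1.hasSum.mul_right _).mul_left _
  have hsumF := hasSum_sum hHas
  -- `Δ_q` as a finite sum over the newforms
  have hpet : ∀ u v : ℕ, KowalskiMichel2000.pet q u v =
      ∑ f ∈ S, (GL2Family.harmonicWeight f : ℂ) *
        (GL2Family.heckeLambda f u * GL2Family.heckeLambda f v) := by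
    intro u v
    unfold KowalskiMichel2000.pet GL2Family.harmonicSum
    rw [finsum_mem_eq_finite_toFinset_sum _ hfin]
  -- pointwise: Σ_f F f n = w(n) · Σ_{d₁,d₂} Δ_q(...)
  have hpt : ∀ n : ℕ × ℕ, ∑ f ∈ S, F f n = (afeWeight q n : ℂ) *
      ∑ d₁ ∈ (l.gcd n.1).divisors, ∑ d₂ ∈ (m.gcd n.2).divisors,
        KowalskiMichel2000.pet q (l * n.1 / d₁ ^ 2) (m * n.2 / d₂ ^ 2) := by
    intro n
    have hLt : ∀ f ∈ S, F f n = (afeWeight q n : ℂ) *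
        ∑ d₁ ∈ (l.gcd n.1).divisors, ∑ d₂ ∈ (m.gcd n.2).divisors,
          (GL2Family.harmonicWeight f : ℂ) *
            (GL2Family.heckeLambda f (l * n.1 / d₁ ^ 2) * GL2Family.heckeLambda f (m * n.2 / d₂ ^ 2)) := by
      intro f hf
      have hf'' : f ∈ newforms0 q 2 := (Set.Finite.mem_toFinset _).1 hf
      have hf' : IsNewform0 f := hf''
      have h1 := heckeLambda_mul_below_level hq hf' hl hlq n.1
      have h2 := heckeLambda_mul_below_level hq hf' hm hmq n.2
      simp only [hF, afeSqTerm_eq]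
      calc (GL2Family.harmonicWeight f : ℂ) * (GL2Family.heckeLambda f n.1 * GL2Family.heckeLambda f n.2 *
              (afeWeight q n : ℂ) * (GL2Family.heckeLambda f l * GL2Family.heckeLambda f m))
          = (afeWeight q n : ℂ) * ((GL2Family.harmonicWeight f : ℂ) *
              ((GL2Family.heckeLambda f l * GL2Family.heckeLambda f n.1) *
                (GL2Family.heckeLambda f m * GL2Family.heckeLambda f n.2))) := by ring
        _ = (afeWeight q n : ℂ) * ((GL2Family.harmonicWeight f : ℂ) *
              ((∑ d₁ ∈ (l.gcd n.1).divisors, GL2Family.heckeLambda f (l * n.1 / d₁ ^ 2)) *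
                (∑ d₂ ∈ (m.gcd n.2).divisors, GL2Family.heckeLambda f (m * n.2 / d₂ ^ 2)))) := by
            rw [h1, h2]
        _ = _ := by
            rw [Finset.sum_mul_sum, Finset.mul_sum]
            congr 1
            exact Finset.sum_congr rfl fun d₁ _ ↦ by rw [Finset.mul_sum]
    rw [Finset.sum_congr rfl hLt, ← Finset.mul_sum]
    congr 1
    rw [Finset.sum_comm]
    refine Finset.sum_congr rfl fun d₁ _ ↦ ?_
    rw [Finset.sum_comm]
    refine Finset.sum_congr rfl fun d₂ _ ↦ ?_
    exact (hpet _ _).symm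
  have hfun : (fun n : ℕ × ℕ ↦ ∑ f ∈ S, F f n) = fun n ↦ (afeWeight q n : ℂ) *
      ∑ d₁ ∈ (l.gcd n.1).divisors, ∑ d₂ ∈ (m.gcd n.2).divisors,
        KowalskiMichel2000.pet q (l * n.1 / d₁ ^ 2) (m * n.2 / d₂ ^ 2) := funext hpt
  rw [hfun] at hsumF
  -- the twisted moment through the AFE
  have hT : twistedSecond q l m = 2 * (qhat q : ℂ) * ∑ f ∈ S, (GL2Family.harmonicWeight f : ℂ) *
      ((∑' n : ℕ × ℕ, afeSqTerm q f n) * (GL2Family.heckeLambda f l * GL2Family.heckeLambda f m)) := by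
    unfold twistedSecond GL2Family.harmonicSum
    rw [finsum_mem_eq_finite_toFinset_sum _ hfin, Finset.mul_sum]
    refine Finset.sum_congr rfl fun f hf ↦ ?_
    have hf' : f ∈ newforms0 q 2 := (Set.Finite.mem_toFinset _).1 hf
    dsimp only
    rw [(completedL_half_sq_eq_holds q hq f hf').2]
    ring
  exact ⟨hsumF.summable, by rw [hT, hsumF.tsum_eq]⟩

end Summit.Parity.GeneralizedHardyLittlewood.Theorems.BeyondDiagonalBeatsQuarter.PeterssonSplit
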